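import Summits.QuantumAdvantage.QuantumAdvantage.Theorems.ArithStatLadderIqThreeNotPPolyClassNumberSharpP
import Summits.QuantumAdvantage.QuantumAdvantage.Theorems.ArithStatLadderIqThreeNotPPolyApexNP
import Summits.QuantumAdvantage.QuantumAdvantage.Theorems.IqThreeNotPPoly.Negative.RefutationShape
import Summits.QuantumAdvantage.QuantumAdvantage.Theorems.IqThreeMemBQP.Negative.RefutationCost
import Literature.Computability.Complexity.GapNatPSpace
import Literature.Computability.Complexity.PSpaceClosure

/-!
# `IQ3 ∈ PSPACE`: the crux's separation strength, unconditionally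

Helper file for the crux `ArithStatLadder.IqThreeNotPPoly` (stmt-QuantumAdvantage-2422, `IQ3 ∉ P/poly`,
`IQ3 = bin {d : −d fundamental, 3 ∣ h(−d)}`), line `Sketch`, continuation lead c3 — part 3 of the
construction. The disprover's `Negative.RefutationShape.PSPACE_not_subset_PPoly_of` (this crux) and
`Negative.RefutationCost.BQP_ne_PSPACE_of_not_iqThreeMemBQP` / `P_ne_PSPACE_of_not_iqThreeMemBQP`
(crux 2424) take the folklore membership **`IQ3 ∈ PSPACE`** as a hypothesis ("count reduced forms in
polynomial space; not constructed in the tree"). It is constructed here (`iqThreeLang_mem_PSPACE`):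

* `3 ∣ h(−⟦w⟧)` (`threeDvdClassNumber_mem_PSPACE`): `w ↦ h(−⟦w⟧)` is a `#P` function (part 2,
  `classNumber_negVal_mem_SharpP`), hence in Ladner's `♮PSPACE ⊆ GapNatPSPACE`
  (`GapNatPSpace.lean`); `3 ∣ h` is the polynomially bounded `∃ y, h(−⟦w⟧) = 3⟦y⟧` over the
  `PSPACE` equality set of two gap functions (`setOf_eq_mem_PSPACE`, `polyExists_mem_PSPACE`);
* `−⟦w⟧` fundamental (`fundVal_mem_PSPACE`): over `ℕ` the literal reads
  `(d ≡ 3 (4) ∧ d squarefree) ∨ (d ≡ 4, 8 (16) ∧ d/4 squarefree)` (`isNegFundamentalDiscr_iff_nat`);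
  the residue tests are `P`-bricks, and `{w | ⟦w⟧ squarefree}`, `{w | ⟦w⟧/4 squarefree}` are `FP`
  preimages of `SQF = bin {m | Squarefree m} ∈ coNP ⊆ PSPACE` (lead c2's `squarefree_mem_coNP`,
  `ApexNP.lean`); unions/intersections through a `PSPACE`-complete set (`PSpaceClosure.lean`);
* `IQ3 = NUM ⊓ FUND ⊓ THREE` with `NUM = {w | bin ⟦w⟧ = w} ∈ P` (canonical numerals).

Consequences, now hypothesis-free: `IqThreeNotPPoly → PSPACE ⊄ P/poly`
(`PSPACE_not_subset_PPoly_of_iqThreeNotPPoly`); `¬ IqThreeMemBQP → P ≠ PSPACE ∧ BQP ≠ PSPACE`;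
`IqThreeNotBPP → BPP ≠ PSPACE`. So each of the route's three hypothesis-type items at the witness
IQ3 is, if settled in the feared direction, a separation of `PSPACE` from a polynomial class — the
barrier `Literature.Barriers.QuantumAdvantage.SeparationPrerequisites`, kernel-checked at this
witness. No definition is introduced. Sorry-free; axioms ⊆ {propext, Classical.choice, Quot.sound}.

References: S. Arora, B. Barak, *Computational Complexity*, CUP 2009, §4.1–4.2 (`PSPACE`, closure
under bounded quantifiers), Def. 17.2 (`#P`); R. E. Ladner, *Polynomial space counting problems*,
SIAM J. Comput. 18 (1989), §1 (`♮PSPACE`); D. A. Cox, *Primes of the form x² + ny²*, 2nd ed., 2013,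
Thm. 2.13; H. Cohen, *A Course in Computational Algebraic Number Theory*, GTM 138, 1993, §5.3
(Def. 5.1.2: fundamental discriminants; Algorithm 5.3.5: counting reduced forms).
-/

noncomputable section

set_option linter.dupNamespace false

namespace Summit.QuantumAdvantage.QuantumAdvantage.Theorems.IqThreeNotPPoly

open _root_.Computability Polynomial
open Literature.Computability.Complexity Literature.Computability.Complexity.Brick
open Literature.Computability.Complexity.Classes (P)
open Literature.Computability.Cryptography (IsNegFundamentalDiscr BQP)
open Literature.NumberTheory.QuadraticFields
open Summit.QuantumAdvantage.QuantumAdvantage.Theses.ArithStatLadder (IqThreeNotPPoly IqThreeMemBQP IqThreeNotBPP)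

/-! ### `{w | 3 ∣ h(−⟦w⟧)} ∈ PSPACE` -/

/-- `w ↦ h(−⟦w⟧)` is a gap function over polynomial space (`#P ⊆ ♮PSPACE ⊆ GapNatPSPACE`). -/
theorem classNumber_negVal_mem_GapNatPSPACE :
    (fun w : List Bool => (BinaryQuadraticForm.classNumber (-(bitsToNat w : ℤ)) : ℤ)) ∈ GapNatPSPACE :=
  natPSPACE_mem_GapNatPSPACE (sharpP_subset_natPSPACE classNumber_negVal_mem_SharpP)

/-- The witness bound: `h(−⟦w⟧) ≤ 2^{3(|w|+1)}`. -/
theorem classNumber_negVal_le_two_pow (w : List Bool) :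
    BinaryQuadraticForm.classNumber (-(bitsToNat w : ℤ)) ≤ 2 ^ (3 * (w.length + 1)) := by
  obtain ⟨R, -, h⟩ := exists_classNumber_relation
  rw [← h w, PPSharpP.countWitnesses_eq_cnt]
  exact cnt_le _ _

/-- **`{w | 3 ∣ h(−⟦w⟧)} ∈ PSPACE`**: `3 ∣ h(−⟦w⟧) ↔ ∃ y, |y| ≤ 3(|w|+1)+1 ∧ h(−⟦w⟧) = 3⟦y⟧`, a
polynomially bounded `∃` over the `PSPACE` equality set of two `GapNatPSPACE` functions. -/
theorem threeDvdClassNumber_mem_PSPACE :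
    {w : List Bool | 3 ∣ BinaryQuadraticForm.classNumber (-(bitsToNat w : ℤ))} ∈ PSPACE := by
  have hA : {z : List Bool | ((fun w : List Bool =>
      (BinaryQuadraticForm.classNumber (-(bitsToNat w : ℤ)) : ℤ)) ∘ fstF) z =
      (3 : ℕ) * (bitsToNat (sndF z) : ℤ)} ∈ PSPACE :=
    setOf_eq_mem_PSPACE (comp_mem_GapNatPSPACE classNumber_negVal_mem_GapNatPSPACE fstF_mem_FP)
      (nsmul_mem_GapNatPSPACE 3 (natFP_mem_GapNatPSPACE sndF_mem_FP))
  have h := polyExists_mem_PSPACE hA (3 * (X + 1) + 1)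
  have key : {w : List Bool | 3 ∣ BinaryQuadraticForm.classNumber (-(bitsToNat w : ℤ))} =
      {x | ∃ y : List Bool, y.length ≤ (3 * (X + 1) + 1 : Polynomial ℕ).eval x.length ∧
        boolPair x y ∈ {z : List Bool | ((fun w : List Bool =>
          (BinaryQuadraticForm.classNumber (-(bitsToNat w : ℤ)) : ℤ)) ∘ fstF) z =
          (3 : ℕ) * (bitsToNat (sndF z) : ℤ)}} := by
    ext w
    simp only [Set.mem_setOf_eq, Function.comp_apply, fstF_boolPair, sndF_boolPair, eval_add,
      eval_mul, eval_ofNat, eval_X, eval_one, Nat.cast_ofNat]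
    constructor
    · rintro ⟨k, hk⟩
      refine ⟨encodeNat k, ?_, ?_⟩
      · refine (Brick.length_encodeNat_le_iff _ _).2 ?_
        have := classNumber_negVal_le_two_pow w
        calc k ≤ 3 * k := by omega
          _ ≤ 2 ^ (3 * (w.length + 1)) := hk ▸ this
          _ < 2 ^ (3 * (w.length + 1) + 1) := Nat.pow_lt_pow_right (by norm_num) (by omega)
      · rw [bitsToNat_encodeNat, hk]
        push_cast
        ring
    · rintro ⟨y, -, hy⟩
      exact ⟨bitsToNat y, by exact_mod_cast hy⟩
  rw [key]
  exact h

/-! ### Fundamentality of `−⟦w⟧` is a `PSPACE` predicate -/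

/-- The route's fundamentality literal over `ℕ`: `−d` is a fundamental discriminant iff
`d ≡ 3 (mod 4)` is squarefree, or `d ≡ 4, 8 (mod 16)` with `d/4` squarefree. -/
theorem isNegFundamentalDiscr_iff_nat (d : ℕ) : IsNegFundamentalDiscr d ↔
    (d % 4 = 3 ∧ Squarefree d) ∨ ((d % 16 = 4 ∨ d % 16 = 8) ∧ Squarefree (d / 4)) := by
  have hsq : ∀ n : ℕ, Squarefree (-(n : ℤ)) ↔ Squarefree n := fun n => by
    rw [← Int.squarefree_natAbs, Int.natAbs_neg, Int.natAbs_natCast]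
  unfold IsNegFundamentalDiscr
  constructor
  · rintro (⟨h1, hsf, -⟩ | ⟨h4, hres, hsf⟩)
    · exact Or.inl ⟨by omega, (hsq d).1 hsf⟩
    · right
      obtain ⟨k, rfl⟩ : ∃ k : ℕ, d = 4 * k := ⟨d / 4, by omega⟩
      have hq : (-((4 * k : ℕ) : ℤ)) / 4 = -(k : ℤ) := by push_cast; omega
      rw [hq] at hres hsf
      rw [Nat.mul_div_cancel_left k (by norm_num)]
      exact ⟨by omega, (hsq k).1 hsf⟩
  · rintro (⟨h3, hsf⟩ | ⟨h16, hsf⟩)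
    · exact Or.inl ⟨by omega, (hsq d).2 hsf, by omega⟩
    · right
      obtain ⟨k, rfl⟩ : ∃ k : ℕ, d = 4 * k := ⟨d / 4, by omega⟩
      rw [Nat.mul_div_cancel_left k (by norm_num)] at hsf
      have hq : (-((4 * k : ℕ) : ℤ)) / 4 = -(k : ℤ) := by push_cast; omega
      rw [hq]
      refine ⟨?_, by omega, (hsq k).2 hsf⟩
      push_cast
      exact dvd_neg.2 (dvd_mul_right 4 _)

/-- `SQF = bin {m | Squarefree m} ∈ PSPACE` (lead c2: `SQF ∈ coNP`; `NP ⊆ PSPACE`, complement). -/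
theorem toLanguage_squarefree_mem_PSPACE :
    encodingNatBool.toLanguage {m : ℕ | Squarefree m} ∈ PSPACE := by
  have h := compl_mem_PSPACE (NP_subset_PSPACE_holds squarefree_compl_mem_NP)
  rwa [compl_compl] at h

/-- `{w | ⟦w⟧ squarefree} ∈ PSPACE`: the `FP` preimage of `SQF` under `w ↦ bin ⟦w⟧`
(`addFn ⟨w, ε⟩`). -/
theorem sqfreeVal_mem_PSPACE : {w : List Bool | Squarefree (bitsToNat w)} ∈ PSPACE := by
  have hg : (addFn ∘ fanoutFn (fun w => w) (fun _ => [])) ∈ FP :=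
    comp_mem_FP addFn_mem_FP (fanoutFn_mem_FP OracleCompose.id_mem_FP (const_mem_FP _))
  have h := preimage_mem_PSPACE toLanguage_squarefree_mem_PSPACE hg
  have key : {w : List Bool | Squarefree (bitsToNat w)} =
      (addFn ∘ fanoutFn (fun w => w) (fun _ => [])) ⁻¹' encodingNatBool.toLanguage {m : ℕ | Squarefree m} := by
    ext w
    show Squarefree (bitsToNat w) ↔
      (addFn ∘ fanoutFn (fun w => w) (fun _ => [])) w ∈ encodingNatBool.toLanguage {m : ℕ | Squarefree m}
    rw [Function.comp_apply, fanoutFn_apply, addFn_boolPair, bitsToNat_nil, Nat.add_zero]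
    exact (encodingNatBool.mem_toLanguage_iff {m : ℕ | Squarefree m} (bitsToNat w)).symm
  rw [key]
  exact h

/-- `{w | ⟦w⟧/4 squarefree} ∈ PSPACE`: the `FP` preimage of `SQF` under `w ↦ bin (⟦w⟧/4)`
(`divFn ⟨w, bin 4⟩`). -/
theorem sqfreeValDivFour_mem_PSPACE : {w : List Bool | Squarefree (bitsToNat w / 4)} ∈ PSPACE := by
  have hg : (divFn ∘ fanoutFn (fun w => w) (fun _ => encodeNat 4)) ∈ FP :=
    comp_mem_FP divFn_mem_FP (fanoutFn_mem_FP OracleCompose.id_mem_FP (const_mem_FP _))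
  have h := preimage_mem_PSPACE toLanguage_squarefree_mem_PSPACE hg
  have key : {w : List Bool | Squarefree (bitsToNat w / 4)} =
      (divFn ∘ fanoutFn (fun w => w) (fun _ => encodeNat 4)) ⁻¹'
        encodingNatBool.toLanguage {m : ℕ | Squarefree m} := by
    ext w
    show Squarefree (bitsToNat w / 4) ↔ (divFn ∘ fanoutFn (fun w => w) (fun _ => encodeNat 4)) w ∈
      encodingNatBool.toLanguage {m : ℕ | Squarefree m}
    rw [Function.comp_apply, fanoutFn_apply, divFn_boolPair, bitsToNat_encodeNat]
    exact (encodingNatBool.mem_toLanguage_iff {m : ℕ | Squarefree m} (bitsToNat w / 4)).symm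
  rw [key]
  exact h

/-- `{w | ⟦w⟧ ≡ 3 (mod 4)} ∈ P` (bricks `remFn`, `eqValFn`). -/
theorem modFourEqThree_mem_P : {w : List Bool | bitsToNat w % 4 = 3} ∈ P := by
  have hg : (eqValFn ∘ fanoutFn (remFn ∘ fanoutFn (fun w => w) (fun _ => encodeNat 4))
      (fun _ => encodeNat 3)) ∈ FP :=
    comp_mem_FP eqValFn_mem_FP (fanoutFn_mem_FP (comp_mem_FP remFn_mem_FP
      (fanoutFn_mem_FP OracleCompose.id_mem_FP (const_mem_FP _))) (const_mem_FP _))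
  have hval : ∀ w, (eqValFn ∘ fanoutFn (remFn ∘ fanoutFn (fun w => w) (fun _ => encodeNat 4))
      (fun _ => encodeNat 3)) w = [decide (bitsToNat w % 4 = 3)] := fun w => by
    simp only [Function.comp_apply, fanoutFn_apply, remFn_boolPair, bitsToNat_encodeNat, eqValFn_boolPair]
  exact mem_P_of_mem_FP hg _ fun w =>
    ⟨fun hw => by rw [hval, decide_eq_true (show bitsToNat w % 4 = 3 from hw)],
      fun hw => by rw [hval, decide_eq_false (show ¬ bitsToNat w % 4 = 3 from hw)]⟩

/-- `{w | ⟦w⟧ ≡ 4, 8 (mod 16)} ∈ P` (bricks `remFn`, `eqValFn`, `orFn`). -/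
theorem modSixteen_mem_P : {w : List Bool | bitsToNat w % 16 = 4 ∨ bitsToNat w % 16 = 8} ∈ P := by
  have hr : (remFn ∘ fanoutFn (fun w => w) (fun _ => encodeNat 16)) ∈ FP :=
    comp_mem_FP remFn_mem_FP (fanoutFn_mem_FP OracleCompose.id_mem_FP (const_mem_FP _))
  have hrv : ∀ w, (remFn ∘ fanoutFn (fun w => w) (fun _ => encodeNat 16)) w = encodeNat (bitsToNat w % 16) :=
    fun w => by simp only [Function.comp_apply, fanoutFn_apply, remFn_boolPair, bitsToNat_encodeNat]
  have h4 : ∀ w, (eqValFn ∘ fanoutFn (remFn ∘ fanoutFn (fun w => w) (fun _ => encodeNat 16))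
      (fun _ => encodeNat 4)) w = [decide (bitsToNat w % 16 = 4)] := fun w => by
    rw [Function.comp_apply, fanoutFn_apply, hrv, eqValFn_boolPair, bitsToNat_encodeNat, bitsToNat_encodeNat]
  have h8 : ∀ w, (eqValFn ∘ fanoutFn (remFn ∘ fanoutFn (fun w => w) (fun _ => encodeNat 16))
      (fun _ => encodeNat 8)) w = [decide (bitsToNat w % 16 = 8)] := fun w => by
    rw [Function.comp_apply, fanoutFn_apply, hrv, eqValFn_boolPair, bitsToNat_encodeNat, bitsToNat_encodeNat]
  have hg : orFn (eqValFn ∘ fanoutFn (remFn ∘ fanoutFn (fun w => w) (fun _ => encodeNat 16))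
      (fun _ => encodeNat 4)) (eqValFn ∘ fanoutFn (remFn ∘ fanoutFn (fun w => w) (fun _ => encodeNat 16))
      (fun _ => encodeNat 8)) ∈ FP :=
    orFn_mem_FP (comp_mem_FP eqValFn_mem_FP (fanoutFn_mem_FP hr (const_mem_FP _)))
      (comp_mem_FP eqValFn_mem_FP (fanoutFn_mem_FP hr (const_mem_FP _)))
  refine mem_P_of_mem_FP hg _ fun w => ⟨fun hw => ?_, fun hw => ?_⟩
  · rw [orFn_apply (h4 w) (h8 w)]
    have hw' : bitsToNat w % 16 = 4 ∨ bitsToNat w % 16 = 8 := hw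
    rcases hw' with e | e <;> simp [e]
  · rw [orFn_apply (h4 w) (h8 w)]
    have hw' : ¬ (bitsToNat w % 16 = 4 ∨ bitsToNat w % 16 = 8) := hw
    have e4 : ¬ bitsToNat w % 16 = 4 := fun e => hw' (Or.inl e)
    have e8 : ¬ bitsToNat w % 16 = 8 := fun e => hw' (Or.inr e)
    simp [e4, e8]

/-- **`{w | −⟦w⟧ is a fundamental discriminant} ∈ PSPACE`.** -/
theorem fundVal_mem_PSPACE : {w : List Bool | IsNegFundamentalDiscr (bitsToNat w)} ∈ PSPACE := by
  obtain ⟨B, hB⟩ := exists_isComplete_PSPACE_holds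
  have h := union_mem_PSPACE_of_complete hB
    (inter_P_mem_PSPACE modFourEqThree_mem_P sqfreeVal_mem_PSPACE)
    (inter_P_mem_PSPACE modSixteen_mem_P sqfreeValDivFour_mem_PSPACE)
  have key : {w : List Bool | IsNegFundamentalDiscr (bitsToNat w)} =
      ({w : List Bool | bitsToNat w % 4 = 3} ⊓ {w : List Bool | Squarefree (bitsToNat w)}) ⊔
      ({w : List Bool | bitsToNat w % 16 = 4 ∨ bitsToNat w % 16 = 8} ⊓
        {w : List Bool | Squarefree (bitsToNat w / 4)}) := by
    ext w
    rw [Set.mem_setOf_eq, isNegFundamentalDiscr_iff_nat]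
    rfl
  rw [key]
  exact h

/-! ### `IQ3 ∈ PSPACE` -/

/-- The canonical numerals `NUM = {w | bin ⟦w⟧ = w} ∈ P` (bricks `addFn ⟨w, ε⟩ = bin ⟦w⟧` and the
string equality `eqPairFn`). -/
theorem numerals_mem_P : {w : List Bool | encodeNat (bitsToNat w) = w} ∈ P := by
  have hg : (eqPairFn ∘ fanoutFn (addFn ∘ fanoutFn (fun w => w) (fun _ => [])) (fun w => w)) ∈ FP :=
    comp_mem_FP eqPairFn_mem_FP (fanoutFn_mem_FP (comp_mem_FP addFn_mem_FP
      (fanoutFn_mem_FP OracleCompose.id_mem_FP (const_mem_FP _))) OracleCompose.id_mem_FP)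
  have hval : ∀ w, (eqPairFn ∘ fanoutFn (addFn ∘ fanoutFn (fun w => w) (fun _ => [])) (fun w => w)) w =
      [decide (encodeNat (bitsToNat w) = w)] := fun w => by
    rw [Function.comp_apply, fanoutFn_apply, Function.comp_apply, fanoutFn_apply, addFn_boolPair,
      bitsToNat_nil, Nat.add_zero, eqPairFn_boolPair]
  exact mem_P_of_mem_FP hg _ fun w =>
    ⟨fun hw => by rw [hval, decide_eq_true (show encodeNat (bitsToNat w) = w from hw)],
      fun hw => by rw [hval, decide_eq_false (show ¬ encodeNat (bitsToNat w) = w from hw)]⟩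

/-- `IQ3 = NUM ⊓ (FUND ⊓ THREE)` as languages over `{0,1}*`. -/
theorem iqThreeLang_eq_inter :
    encodingNatBool.toLanguage
        {d : ℕ | IsNegFundamentalDiscr d ∧ 3 ∣ BinaryQuadraticForm.classNumber (-(d : ℤ))} =
      {w : List Bool | encodeNat (bitsToNat w) = w} ⊓
        ({w : List Bool | IsNegFundamentalDiscr (bitsToNat w)} ⊓
          {w : List Bool | 3 ∣ BinaryQuadraticForm.classNumber (-(bitsToNat w : ℤ))}) := by
  ext w
  constructor
  · rintro ⟨d, ⟨hF, h3⟩, rfl⟩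
    change encodeNat (bitsToNat (encodeNat d)) = encodeNat d ∧
      IsNegFundamentalDiscr (bitsToNat (encodeNat d)) ∧
        3 ∣ BinaryQuadraticForm.classNumber (-(bitsToNat (encodeNat d) : ℤ))
    rw [bitsToNat_encodeNat]
    exact ⟨rfl, hF, h3⟩
  · rintro ⟨hN, hF, h3⟩
    change encodeNat (bitsToNat w) = w at hN
    exact ⟨bitsToNat w, ⟨hF, h3⟩, hN⟩

/-- **`IQ3 ∈ PSPACE`** (the `IsNegFundamentalDiscr` spelling of `HallgrenClassGroup.lean`, verbatim
the route's inline disjunction). -/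
theorem iqThreeLang_mem_PSPACE' :
    encodingNatBool.toLanguage
      {d : ℕ | IsNegFundamentalDiscr d ∧ 3 ∣ BinaryQuadraticForm.classNumber (-(d : ℤ))} ∈ PSPACE := by
  obtain ⟨B, hB⟩ := exists_isComplete_PSPACE_holds
  rw [iqThreeLang_eq_inter]
  exact inter_P_mem_PSPACE numerals_mem_P
    (inter_mem_PSPACE_of_complete hB fundVal_mem_PSPACE threeDvdClassNumber_mem_PSPACE)

/-- **`IQ3 ∈ PSPACE`**, stated over the route file's literal set
`{d | ((−d) % 4 = 1 ∧ Squarefree (−d) ∧ −d ≠ 1 ∨ 4 ∣ −d ∧ ((−d)/4 % 4 = 2 ∨ (−d)/4 % 4 = 3) ∧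
Squarefree ((−d)/4)) ∧ 3 ∣ h(−d)}` — the folklore hypothesis of
`Negative.RefutationShape.PSPACE_not_subset_PPoly_of` and of crux 2424's
`Negative.RefutationCost.{BQP,P}_ne_PSPACE_of_not_iqThreeMemBQP`, discharged. -/
theorem iqThreeLang_mem_PSPACE :
    encodingNatBool.toLanguage {d : ℕ | (((-(d:ℤ)) % 4 = 1 ∧ Squarefree (-(d:ℤ)) ∧ (-(d:ℤ)) ≠ 1) ∨ (4 ∣ (-(d:ℤ)) ∧ ((-(d:ℤ)) / 4 % 4 = 2 ∨ (-(d:ℤ)) / 4 % 4 = 3) ∧ Squarefree ((-(d:ℤ)) / 4))) ∧ 3 ∣ Literature.NumberTheory.QuadraticFields.BinaryQuadraticForm.classNumber (-(d:ℤ))} ∈ PSPACE :=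
  iqThreeLang_mem_PSPACE'

/-! ### Consequences: the three hypothesis-type items at IQ3 are `PSPACE` separations -/

/-- **The crux separates `PSPACE` from `P/poly`** — unconditionally in the crux:
`IqThreeNotPPoly → ¬ PSPACE ⊆ P/poly` (the disprover's `PSPACE_not_subset_PPoly_of` with its folklore
hypothesis discharged). -/
theorem PSPACE_not_subset_PPoly_of_iqThreeNotPPoly (h : IqThreeNotPPoly) : ¬ PSPACE ⊆ PPoly :=
  Negative.PSPACE_not_subset_PPoly_of h iqThreeLang_mem_PSPACE'

/-- **A refutation of crux 2424 (`IQ3 ∈ BQP`) separates `P` and `BQP` from `PSPACE`** —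
crux 2424's `Negative.RefutationCost` lemmas with their folklore hypothesis discharged. -/
theorem P_ne_PSPACE_and_BQP_ne_PSPACE_of_not_iqThreeMemBQP (h : ¬ IqThreeMemBQP) :
    P ≠ PSPACE ∧ BQP ≠ PSPACE :=
  ⟨IqThreeMemBQP.Negative.P_ne_PSPACE_of_not_iqThreeMemBQP h iqThreeLang_mem_PSPACE',
    IqThreeMemBQP.Negative.BQP_ne_PSPACE_of_not_iqThreeMemBQP h iqThreeLang_mem_PSPACE'⟩

/-- **The binder `IqThreeNotBPP` (`IQ3 ∉ BPP`, item 14864) separates `BPP` from `PSPACE`.** -/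
theorem BPP_ne_PSPACE_of_iqThreeNotBPP (h : IqThreeNotBPP) : BPP ≠ PSPACE :=
  fun hEq => h (hEq ▸ iqThreeLang_mem_PSPACE)

end Summit.QuantumAdvantage.QuantumAdvantage.Theorems.IqThreeNotPPoly

end
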